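import Literature.Computability.Complexity.AOWAsymptotics
import Literature.Computability.Complexity.AOWProgramFP
import Literature.Computability.Complexity.BPPErrorReduction
import Literature.Computability.Complexity.LengthCompare
import HarnessLib

/-!
# Discharge of `allen_odonnell_witmer_kSAT` (Allen–O'Donnell–Witmer 2015, Thm. 2.3 for `k`-SAT)

Trunk T-CPLX-CORE (Literature/Computability/Complexity). This file closes the named fact of
`AOWRefutation.lean`:

`theorem allen_odonnell_witmer_kSAT_holds : allen_odonnell_witmer_kSAT`.

The witness, for `k ≥ 3`: constants `C = 1`, `c = 4`, and the randomized algorithm (using no coins)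
`A = witnessAlg L 0` of the language `L = {w | F (fstF w) = [1]}`, where `F ∈ FP` computes the
refuter `aowRefute k` on codes (`AOWProg.exists_fp_aowRefute`, the machine form of `AOWAccepts.lean`
through `AOWProgram.lean` / `AOWProgramFP.lean`):

* **PPT**: `L ∈ P` (`mem_P_of_mem_FP` on the one-bit normalisation `isTrue1Fn ∘ F ∘ fstF`), hence
  `witnessAlg L 0` is PPT (`witnessAlg_isPolyTime`);
* **soundness** (`Pr[true] = 0` on satisfiable inputs): the run is the constant `aowRefute k n φ`, which
  is `false` on satisfiable `φ` (`not_satisfiable_of_aowRefute`);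
* **success**: the verdict law on `φ ∼ F_{OR_k}(n, p)` is the push-forward of `subsetPMF` under
  `T ↦ [AOWAccepts k n q T]` (the algorithm sees exactly the sampled constraints,
  `parseConstraints_map_toClause`), so `Pr[true] = ofReal P[accept] → 1` by
  `tendsto_subsetProb_aowAccepts` (`AOWAsymptotics.lean`: second/`2q`-th moment method with `q = Θ(k log n)`,
  under `m̄ ≥ n^{k/2} (log n)^4`).

## References

* S. R. Allen, R. O'Donnell, D. Witmer, *How to refute a random CSP*, FOCS 2015, arXiv:1505.04383,
  Thm. 2.3, Def. 3.1, Def. 3.7, App. A.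
-/

noncomputable section

namespace Literature.Computability.Complexity

open Filter Topology _root_.Computability Literature.Computability.Cryptography Brick

/-- The witness language of the refuter's machine: `L_F = {w | F (fstF w) = [1]}`. [folklore] -/
def aowLang (F : List Bool → List Bool) : Language Bool := {w | F (fstF w) = [true]}

/-- `L_F ∈ P` for `F ∈ FP` (one-bit normalisation of `F ∘ fstF`). [cite: AroraBarak2009, Def. 1.13] -/
theorem aowLang_mem_P {F : List Bool → List Bool} (hF : F ∈ FP) : aowLang F ∈ Classes.P := by
  refine mem_P_of_mem_FP (g := isTrue1Fn ∘ F ∘ fstF)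
    (comp_mem_FP isTrue1Fn_mem_FP (comp_mem_FP hF fstF_mem_FP)) (aowLang F) fun w => ⟨fun hw => ?_, fun hw => ?_⟩
  · simp only [Function.comp_apply, isTrue1Fn_apply]
    rw [decide_eq_true (show F (fstF w) = [true] from hw)]
  · simp only [Function.comp_apply, isTrue1Fn_apply]
    rw [decide_eq_false (show ¬ F (fstF w) = [true] from hw)]

/-- **The refuter's randomized algorithm** (no coins): `witnessAlg L_F 0`. [cite: arXiv150504383, Thm. 2.3] -/
def aowAlg (F : List Bool → List Bool) : RandAlg (List Bool) Bool := witnessAlg (aowLang F) 0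

/-- The run of the refuter's algorithm on the code of `(n, φ)` is `aowRefute k n φ`, whatever the coins.
[folklore] -/
theorem aowAlg_run {k : ℕ} {F : List Bool → List Bool}
    (hFr : ∀ (n : ℕ) (φ : CNF ℕ), F (boolPair (unaryEncodeNat n) (encodingCNF.encode φ)) = [aowRefute k n φ])
    (n : ℕ) (φ : CNF ℕ) (r : List Bool) :
    (aowAlg F).run (boolPair (unaryEncodeNat n) (encodingCNF.encode φ)) r = aowRefute k n φ := by
  change (aowLang F).boolIndicator (boolPair (boolPair (unaryEncodeNat n) (encodingCNF.encode φ)) r) = _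
  have hmem : boolPair (boolPair (unaryEncodeNat n) (encodingCNF.encode φ)) r ∈ aowLang F ↔
      aowRefute k n φ = true := by
    change F (fstF _) = [true] ↔ _
    rw [fstF_boolPair, hFr]
    simp
  cases h : aowRefute k n φ
  · exact (Set.notMem_iff_boolIndicator _ _).1 (fun hm => by simpa [h] using hmem.1 hm)
  · exact (Set.mem_iff_boolIndicator _ _).1 (hmem.2 h)

/-- The output law of the refuter's algorithm is the Dirac mass at `aowRefute k n φ`. [folklore] -/
theorem aowAlg_outputPMF {k : ℕ} {F : List Bool → List Bool}
    (hFr : ∀ (n : ℕ) (φ : CNF ℕ), F (boolPair (unaryEncodeNat n) (encodingCNF.encode φ)) = [aowRefute k n φ])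
    (n : ℕ) (φ : CNF ℕ) :
    (aowAlg F).outputPMF id (boolPair (unaryEncodeNat n) (encodingCNF.encode φ)) = PMF.pure (aowRefute k n φ) := by
  rw [RandAlg.outputPMF]
  have : (fun r : List.Vector Bool ((aowAlg F).coinLen (id (boolPair (unaryEncodeNat n) (encodingCNF.encode φ))).length) =>
      (aowAlg F).run (boolPair (unaryEncodeNat n) (encodingCNF.encode φ)) r.toList) =
      Function.const _ (aowRefute k n φ) := funext fun r => aowAlg_run hFr n φ r.toList
  rw [this]
  exact PMF.map_const _ _

/-- **The verdict law is the push-forward of the binomial law under the acceptance test**: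
`Pr[refute] = ofReal P_{T ∼ subsetPMF}[AOWAccepts k n q T]`. [cite: arXiv150504383, Def. 3.7] -/
theorem refuteLaw_aowAlg_true {k : ℕ} {F : List Bool → List Bool}
    (hFr : ∀ (n : ℕ) (φ : CNF ℕ), F (boolPair (unaryEncodeNat n) (encodingCNF.encode φ)) = [aowRefute k n φ])
    (n : ℕ) (p : ℝ) :
    refuteLaw (aowAlg F) k n p true =
      ENNReal.ofReal (subsetProb (AOWConstraint k n) p fun T => AOWAccepts k n (aowTraceExp k n) T.toList) := by
  classical
  have hbind : refuteLaw (aowAlg F) k n p = (aowKSAT k n p).map (aowRefute k n) := by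
    rw [refuteLaw, ← PMF.bind_pure_comp]
    congr 1
    funext φ
    exact aowAlg_outputPMF hFr n φ
  rw [hbind, aowKSAT, PMF.map_comp, ← PMF.toOuterMeasure_apply_singleton, PMF.toOuterMeasure_map_apply]
  have hset : (aowRefute k n ∘ fun T : Finset (AOWConstraint k n) => T.toList.map AOWConstraint.toClause) ⁻¹' {true} =
      {T | AOWAccepts k n (aowTraceExp k n) T.toList} := by
    ext T
    simp only [Set.mem_preimage, Function.comp_apply, Set.mem_singleton_iff, Set.mem_setOf_eq, aowRefute,
      parseConstraints_map_toClause, decide_eq_true_eq]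
  rw [hset, ← ENNReal.ofReal_toReal (a := (subsetPMF (AOWConstraint k n) p).toOuterMeasure _), toOuterMeasure_subsetPMF_toReal]
  · rfl
  · exact ne_top_of_le_ne_top ENNReal.one_ne_top
      (((subsetPMF (AOWConstraint k n) p).toOuterMeasure.mono (Set.subset_univ _)).trans
        (le_of_eq ((PMF.toOuterMeasure_apply_eq_one_iff _ _).2 (Set.subset_univ _))))

/-- **Discharge of `allen_odonnell_witmer_kSAT`** (Allen–O'Donnell–Witmer 2015, Thm. 2.3 for
`P = OR_k`, with Def. 3.1 and Def. 3.7): for `k ≥ 3`, with `C = 1`, `c = 4` and the coin-free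
algorithm `aowAlg F` (`F ∈ FP` the machine of `aowRefute k`), PPT + never errs + refutes
`F_{OR_k}(n, p(n))` with probability `→ 1` whenever eventually `n^{k/2} (log n)^4 ≤ 2^k n^k p(n)`.
[cite: arXiv150504383, Thm. 2.3] -/
theorem allen_odonnell_witmer_kSAT_holds : allen_odonnell_witmer_kSAT := by
  intro k hk
  obtain ⟨F, hF, hFr⟩ := AOWProg.exists_fp_aowRefute k
  refine ⟨1, 4, aowAlg F, one_pos, witnessAlg_isPolyTime (aowLang_mem_P hF) 0, ?_, ?_⟩
  · -- soundness
    intro φ hφ n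
    rw [aowAlg_outputPMF hFr n φ, PMF.pure_apply]
    have hfalse : aowRefute k n φ = false := by
      cases h : aowRefute k n φ
      · rfl
      · exact absurd hφ (not_satisfiable_of_aowRefute (k := k) (n := n) (by omega) h)
    rw [hfalse]
    simp
  · -- success
    intro p hp hH
    have hH' : ∀ᶠ n : ℕ in atTop, (n : ℝ) ^ ((k : ℝ) / 2) * Real.log n ^ (4 : ℝ) ≤ 2 ^ k * (n : ℝ) ^ k * p n := by
      filter_upwards [hH] with n hn
      rwa [one_mul] at hn
    have ht := tendsto_subsetProb_aowAccepts hk hp hH'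
    have := ENNReal.tendsto_ofReal ht
    rw [ENNReal.ofReal_one] at this
    refine this.congr fun n => ?_
    rw [refuteLaw_aowAlg_true hFr]

end Literature.Computability.Complexity
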